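import Literature.MathematicalPhysics.QuantumFieldTheory.Balaban1983to89.B15Membership195
import Literature.MathematicalPhysics.QuantumFieldTheory.Balaban1983to89.B15Ineq194Flow

/-!
# `Balaban1983to89.B15.RadiiAlongFlow` (v1) — the radii `α̃₀ = {α_{0,j}}` of [III] (2.28) ALONG THE FLOW: the
`α₀`-instance of the first member of [III] (2.8) (*"Similar inequalities hold for other constants"*), and the three
cross-scale side conditions of the tree it discharges BY NAME (`B15.Membership195.rowRung_of_top ∕ rungRows_of_top`:
`hdom`; `B14Radii.room_mono_layer`: `hα`; `B15.Membership195.bare_two_fits_rung`: `hεα ∧ hG`)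

CITATION HEADER (lean-in-tree rule 2026-08-18).  Sources: ([III] = cell paper B14) T. Bałaban, *Convergent
renormalization expansions for lattice gauge theories*, Comm. Math. Phys. **119**, 243–285 (1988), bib
`Balaban1988Convergent` (held: `paper:balaban1988-cmp119-convergent-renormalization`; journal page = PDF page + 242);
([IV] = cell paper B15 = primary P15) T. Bałaban, *Large field renormalization. I. The basic step of the 𝐑 operation*,
Comm. Math. Phys. **122**, 175–202 (1989), bib `Balaban1989LargeFieldI`; ([I] = B12) T. Bałaban, *Renormalization
group approach to lattice gauge field theories. I*, Comm. Math. Phys. **109**, 249–301 (1987), bib `Balaban1987RG1`.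
All three are manuscripts UNDER ADJUDICATION by the audit cell `pub-balaban`; NOTHING of them is asserted here as a
fact: every display enters as a `def … : Prop`, a hypothesis, or a quotation.  The two quotations this module adds to
the lineage were READ AS IMAGES on the x2 page renders of the cell
(`run/shared/lean/pub/pub-balaban/b2b-balaban-ref1/pages/1988-cmp119-convergent-renormalization/…-p014-x2.png` and
`…-p017-x2.png` = [III] pp. 256, 259), not on an OCR layer:

* [III] p. 256 [PDF 14], display (2.8) and the sentence after (2.9): *"ε_n ≤ (1+β₀)(n−m)^{1/2} ε_m , ε_m ≤
  (1+β₀)(1 + g_n²β′(n−m))^{β₀} ε_n ≤ (1+β₀)²(n−m)^{β₀} ε_n , (2.8)"* … *"Similar inequalities hold for other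
  constants, which will be introduced later."*
* [III] p. 259 [PDF 17], (2.28) and the sentence around it: *"The numbers α_{0,j}, α_{1,j} in the symbol of the space
  are given by α_{0,j} = g_jC₀(log g_j⁻²)^{q₀} , α_{1,j} = g_jC₁(log g_j⁻²)^{q₁} , (2.28) where q₀, q₁ are integers
  greater than 1, C₀, C₁ are sufficiently large positive numbers."* (the couplings run by (2.24) on the same page,
  *"generalzing"* [sic] *"Eqs. (I.0.20) and (1.27)"*; *"Thus g_j²(x) = g_j² on the last domain"*).

Everything else is cited BY NAME from tree modules whose own headers carry the page-level readings:
`…B15ComplexSpaces` Part E (`alphaB14`, `logInvSq`: (2.28) schematic), `…B15Membership195` Part F (the rows of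
(1.68)(iii) [IV] p. 191 below the top rung, unit `α_{0,m}η²(L^mη)^{−2} = α_{0,m}L^{2(k−m)}η²`; `rowRung_of_top`,
`rungRows_of_top`, `bare_two_fits_rung`, `clause168_rung_of_180`, `lfFactor_rung_ge`, `cConst_below`), `…B14Radii`
§D (`room`, `room_mono_layer`: [III] p. 277 reading R1; `fits_of_exponents`: the cell's RECONSTRUCTED exponent
restriction (X12) `p₀ ≤ q₀`, `HOME/SMALLNESS.md` §4.1 — NOT printed), `…B14FlowStep` (`SmallnessFor`;
`flowIneq28a_signfree`: the first member of (2.8) for the profile `g ↦ g·A(log g⁻²)^p`, SIGN-FREE, from (I.0.20)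
= `Flow.SatisfiesRG`, `0 < g_k ≤ γ` = `Flow.InInterval`, the PRINTED upper bound `β_{j+1}(g_j) ≤ β′` and the
explicit smallness clauses), `…B15Ineq194Flow` (unit r2-g20: the PRECEDENT — the `δ′`-instance of the same
sentence of p. 256 —, `flatFlow` for non-vacuity).

WHAT THIS MODULE DOES (audit cell `pub-balaban`, unit `b2b-balaban-b01-g28` = PAPER SUB-CELL B01, P15/B15 fallback
lineage, generation 28; one kernel node; value = KERNEL BOOKKEEPING between typed shapes of two papers of the
series, NOT summit progress and NOT a claim about the adjudicated mathematics).

(A) `alphaK C₀ q₀ F j := alphaB14 C₀ (g_j) (log g_j⁻²) q₀` IS the tree profile `Setup.epsK C₀ q₀ F j` with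
`(A₀, p₀) ↦ (C₀, q₀)` (`alphaK_eq_epsK`, by `ring`); hence, BY NAME from `B14FlowStep.flowIneq28a_signfree`, the
`α₀`-instance of the first member of (2.8): **`α_{0,n} ≤ (1+β₀)(n−m)^{1/2} α_{0,m}` for all `m < n ≤ K`**
(`alphaK_flow_signfree`) — along any flow solving (I.0.20) in `]0, γ]` with `β ≤ β′` and
`SmallnessFor γ β′ β₀ L q₀`; no sign of the β-functions, no monotonicity of the couplings.

(B) [folklore] arithmetic `√d ≤ d ≤ 2^{d−1} ≤ B^{d−1}` (`B ≥ 2`, `d ≥ 1`): a POLYNOMIAL loss `A√d` is absorbed by a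
GEOMETRIC gain `c·B^d` as soon as it is absorbed at lag one, `A ≤ cB` (`poly_le_geom`, strict form `poly_lt_geom`).

(C) The three cross-scale side conditions which the tree carried as undischarged hypotheses — each a comparison of
radii `α_{0,·}` at two scales against the gain `L²` per scale — follow from (A)+(B) under ONE explicit clause
each, relating `L` to `β₀` (and to the line constant `β` of [IV] (1.64)–(1.68)), with NO smallness of the coupling
and NO dependence on `M`:
  (a) `hdom` of `Membership195.rowRung_of_top` ∕ `rungRows_of_top` («the top rung BINDS»):
      `3α_{0,k} ≤ (1−2β)·α_{0,m}L^{2(k−m)}` for all `m < k ≤ K` from `3(1+β₀) ≤ (1−2β)L²` (`hdom_of_flow`,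
      `rungRows_of_top_flow`, and fed by (1.80): `clause168_rungs_of_top_flow`); the clause holds for every `L ≥ 3`
      when `β ≤ 1/4` (`SmallnessFor` carries `Lβ₀ ≤ 1`): `hdom_clause_of_three_le`;
  (b) `hα` of `B14Radii.room_mono_layer` (docstring: *"NOT discharged here"*): `α_{0,k} ≤ (L²/2)^{k−n} α_{0,n}` for
      all `n ≤ k ≤ K` with NO extra clause at all (`SmallnessFor` carries `L ≥ 2`, `β₀ ≤ 1`, and `1+β₀ ≤ 2 ≤ L²/2`):
      `alphaK_le_halfpow`, `room_mono_layer_flow`;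
  (c) the pair `hεα : ε_k < α_{0,m}`, `hG : 4 ≤ G` of `Membership195.bare_two_fits_rung`: replaced by the flow, the
      reconstructed (X12) `p₀ ≤ q₀` and `2(A₀/C₀)(1+β₀) < (1−2β)L²` (`bare_two_fits_rung_flow`; the clause holds for
      `A₀ ≤ C₀` — (2.28) *"C₀ … sufficiently large"* —, `β ≤ 1/4`, `L ≥ 3`: `bare_clause_of_three_le`).
  LOCATED REMARK on (c) (prose, no kernel claim beyond the theorems named): the bare comparison `ε_k < α_{0,m}`
  relates constants at DIFFERENT scales without the gain; along the flow `ε_k/α_{0,m} = (A₀/C₀)(g_k/g_m)·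
  (log g_k⁻²)^{p₀}/(log g_m⁻²)^{q₀}` carries the coupling ratio `g_k/g_m`, and (I.0.20) telescoped gives
  `(g_k/g_m)² ≥ 1 + b·g_k²(k−m)` under a positive floor `b` of the β-functions (`B14Sum246Ratio.ratio_sq_ge_of_lag`,
  unit strat-b14) — so `hεα` is NOT uniform in the lag `k − m`, while the `G`-weighted clause of (c) is.  Whether the
  analogous direct discharge of the FULL rows `(2 + C·B₃B₅M⁵)ε_k ≤ lfFactor·α_{0,m}G` (coefficient growing with `M`)
  is compatible with the papers' choice of `M` relative to `L` is NOT examined here; for those rows the operative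
  route is (a): the top-rung row (a `g`-smallness ∕ (X12) matter, NOT CERTIFIED (f) of `…B15Membership195`) plus
  `3(1+β₀) ≤ (1−2β)L²`.
(D) NON-VACUITY: the hypotheses of (a)–(c) are jointly satisfiable (`smallnessFor_L4`, `hypotheses_inhabited`:
the flat flow of `…B15Ineq194Flow`, `γ = e^{−10}`, `β′ = 1`, `β₀ = 1/4`, `L = 4`, `q₀ = 2`, `β = 1/4`, `A₀ = C₀`).

HYPOTHESES THAT STAY HYPOTHESES (nothing below discharges them): the flow control `0 < g_k ≤ γ` ([I] Theorem 2,
unproved in print — cell EXPLICIT TARGET (ii)); the RG equations (I.0.20) along the flow; the printed bound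
`β_{j+1}(g_j) ≤ β′` ([I] p. 264); the explicit smallness `SmallnessFor γ β′ β₀ L q₀` (what *"if g is sufficiently
small"*, [III] p. 255, has to mean for the exponent `q₀`); the IDENTIFICATION of [IV]'s `α̃₀ = {α_{0,m}}` with
[III] (2.28) (a reading — NOT CERTIFIED (f) of `…B15Membership195`, Part E docstring of `…B15ComplexSpaces`); the
exponent restriction (X12) `p₀ ≤ q₀` (the cell's reconstruction, `B14Radii.exponent_necessary`; (2.28) prints only
*"integers greater than 1"*); the top-rung row `hR` of (a).  The module decides nothing about the printed domain of
(1.80) (READING C vs L of `…B15Membership195` (r1′); GAPS G-adv7-25): Part F of that module, and hence (a), (c) here,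
are stated on the rungs `j+1 ≤ m < k` whichever reading supplies the plaquettes.

VERSIONS.  v1 (this file): Parts A–D, unit b2b-balaban-b01-g28 (journal CLAIM B01-G28-RADIIFLOW).  HONEST FRAMING:
a typed skeleton ∕ kernel certificate of bookkeeping implications with explicit constants; NOT progress on any open
problem, and no endorsement of the manuscripts under audit.
-/

namespace Literature.MathematicalPhysics.QuantumFieldTheory.Balaban1983to89.B15.RadiiAlongFlow

open Literature.MathematicalPhysics.QuantumFieldTheory.Balaban1983to89
open BasicStep (lfFactor)
open ComplexSpaces (alphaB14 logInvSq logInvSq_pos Clause164 Clause168 cConst)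
open Literature.MathematicalPhysics.QuantumFieldTheory.Balaban1983to89.B14FlowStep

/-! ## Part A. (2.28) along a flow is the profile `Setup.epsK` with constants `(C₀, q₀)`; the `α₀`-instance of (2.8) -/

/-- The radii of [Balaban1988Convergent] (2.28) p. 259 along a coupling flow `F`: `α_{0,j} = g_j·C₀·(log g_j⁻²)^{q₀}`
(= `ComplexSpaces.alphaB14 C₀ g_j (logInvSq g_j) q₀`; for `α̃₁` take `(C₁, q₁)`). [cite: Balaban1988Convergent, (2.28) p.259] -/
noncomputable def alphaK (C₀ : ℝ) (q₀ : ℕ) (F : Flow) (j : ℕ) : ℝ := alphaB14 C₀ (F.g j) (logInvSq (F.g j)) q₀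

/-- (2.28) is the profile (2.4) `ε_j = g_j·A₀(log g_j⁻²)^{p₀}` = `Setup.epsK` with `(A₀, p₀) ↦ (C₀, q₀)`. [cite: Balaban1988Convergent, (2.28) p.259] -/
theorem alphaK_eq_epsK (C₀ : ℝ) (q₀ : ℕ) (F : Flow) (j : ℕ) : alphaK C₀ q₀ F j = epsK C₀ q₀ F j := by
  unfold alphaK alphaB14 logInvSq epsK p0Profile; ring

/-- Pointwise form of the same identity: `alphaB14 C g (log g⁻²) q = g · p0Profile C q g`. [cite: Balaban1988Convergent, (2.28) p.259] -/
theorem alphaB14_eq_profile (C g : ℝ) (q : ℕ) : alphaB14 C g (logInvSq g) q = g * p0Profile C q g := by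
  unfold alphaB14 logInvSq p0Profile; ring

section AlongFlow
variable (F : Flow) (K : ℕ) {γ β' β₀ : ℝ} {L q₀ : ℕ}

/-- `α_{0,j} ≥ 0` for `0 < g_j ≤ 1`, `C₀ ≥ 0`. [folklore] -/
theorem alphaK_nonneg {C₀ : ℝ} (hC₀ : 0 ≤ C₀) {j : ℕ} (hg : 0 < F.g j) (hg1 : F.g j ≤ 1) :
    0 ≤ alphaK C₀ q₀ F j := by
  unfold alphaK alphaB14 logInvSq
  have hlog : 0 ≤ Real.log ((F.g j) ^ 2)⁻¹ := log_inv_sq_nonneg hg hg1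
  exact mul_nonneg (mul_nonneg hg.le hC₀) (pow_nonneg hlog _)

/-- `α_{0,j} > 0` for `0 < g_j < 1`, `C₀ > 0`. [folklore] -/
theorem alphaK_pos {C₀ : ℝ} (hC₀ : 0 < C₀) {j : ℕ} (hg : 0 < F.g j) (hg1 : F.g j < 1) :
    0 < alphaK C₀ q₀ F j := by
  unfold alphaK alphaB14
  exact mul_pos (mul_pos hg hC₀) (pow_pos (logInvSq_pos hg hg1) _)

/-- **The `α₀`-instance of the first member of (2.8)** (*"Similar inequalities hold for other constants, which will
be introduced later"*, p. 256): along a flow solving (I.0.20) with `0 < g_k ≤ γ`, the PRINTED `β_{j+1}(g_j) ≤ β′`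
and `SmallnessFor γ β′ β₀ L q₀`, for all `m < n ≤ K`: `α_{0,n} ≤ (1+β₀)(n−m)^{1/2} α_{0,m}` — SIGN-FREE, BY NAME
from `B14FlowStep.flowIneq28a_signfree` at `(C₀, q₀)`. [cite: Balaban1988Convergent, (2.8) p.256] -/
theorem alphaK_flow_signfree (S : SmallnessFor γ β' β₀ L q₀) {C₀ : ℝ} (hC₀ : 0 ≤ C₀)
    (hrg : F.SatisfiesRG K) (hI : F.InInterval γ K) (hub : ∀ j, j < K → F.β (j + 1) (F.g j) ≤ β')
    {m n : ℕ} (hmn : m < n) (hnK : n ≤ K) :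
    alphaK C₀ q₀ F n ≤ (1 + β₀) * Real.sqrt ((n : ℝ) - m) * alphaK C₀ q₀ F m := by
  rw [alphaK_eq_epsK, alphaK_eq_epsK]
  exact flowIneq28a_signfree F K S hC₀ hrg hI hub hmn hnK

/-- `log g⁻² ≥ 1` on `]0, γ]` under `SmallnessFor.h27a` (`4q₀ + 2 ≤ log γ⁻²`). [folklore] -/
theorem one_le_logInvSq (S : SmallnessFor γ β' β₀ L q₀) {g : ℝ} (hg : 0 < g) (hgγ : g ≤ γ) :
    1 ≤ logInvSq g := by
  unfold logInvSq
  have h27a := S.h27a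
  have hq : (0 : ℝ) ≤ (q₀ : ℝ) := Nat.cast_nonneg q₀
  have h1 : (1 : ℝ) ≤ Real.log (γ ^ 2)⁻¹ := by linarith
  exact le_trans h1 (log_inv_sq_mono hg hgγ)

end AlongFlow

/-! ## Part B. [folklore] A polynomial loss in the lag is absorbed by a geometric gain -/

/-- `√d ≤ B^{d−1}` for `B ≥ 2`, `d ≥ 1` (via `√d ≤ d ≤ 2^{d−1}`, Mathlib `Nat.lt_two_pow_self`). [folklore] -/
theorem sqrt_le_pow_pred {B : ℝ} (hB : 2 ≤ B) {d : ℕ} (hd : 1 ≤ d) : Real.sqrt (d : ℝ) ≤ B ^ (d - 1) := by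
  obtain ⟨e, rfl⟩ : ∃ e, d = e + 1 := ⟨d - 1, by omega⟩
  rw [Nat.add_sub_cancel]
  have hd1 : (1 : ℝ) ≤ ((e + 1 : ℕ) : ℝ) := by exact_mod_cast hd
  have h1 : Real.sqrt ((e + 1 : ℕ) : ℝ) ≤ ((e + 1 : ℕ) : ℝ) := by
    rw [Real.sqrt_le_left (by linarith)]
    nlinarith
  have h2 : ((e + 1 : ℕ) : ℝ) ≤ (2 : ℝ) ^ e := by exact_mod_cast (Nat.lt_two_pow_self : e + 1 ≤ 2 ^ e)
  have h3 : (2 : ℝ) ^ e ≤ B ^ e := pow_le_pow_left₀ (by norm_num) hB e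
  linarith

/-- POLYNOMIAL VS GEOMETRIC: `A ≥ 0`, `B ≥ 2`, `A ≤ c·B` and `d ≥ 1` give `A·√d ≤ c·B^d`. [folklore] -/
theorem poly_le_geom {A c B : ℝ} (hA : 0 ≤ A) (hB : 2 ≤ B) (hAc : A ≤ c * B) {d : ℕ} (hd : 1 ≤ d) :
    A * Real.sqrt (d : ℝ) ≤ c * B ^ d := by
  have hs := sqrt_le_pow_pred hB hd
  have hBp : 0 ≤ B ^ (d - 1) := pow_nonneg (by linarith) _
  have e : B ^ d = B * B ^ (d - 1) := by
    obtain ⟨e, rfl⟩ : ∃ e, d = e + 1 := ⟨d - 1, by omega⟩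
    rw [Nat.add_sub_cancel, pow_succ]; ring
  calc A * Real.sqrt (d : ℝ) ≤ A * B ^ (d - 1) := mul_le_mul_of_nonneg_left hs hA
    _ ≤ (c * B) * B ^ (d - 1) := mul_le_mul_of_nonneg_right hAc hBp
    _ = c * B ^ d := by rw [e]; ring

/-- Strict form: `A ≥ 0`, `B ≥ 2`, `A < c·B`, `d ≥ 1` give `A·√d < c·B^d`. [folklore] -/
theorem poly_lt_geom {A c B : ℝ} (hA : 0 ≤ A) (hB : 2 ≤ B) (hAc : A < c * B) {d : ℕ} (hd : 1 ≤ d) :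
    A * Real.sqrt (d : ℝ) < c * B ^ d := by
  have hs := sqrt_le_pow_pred hB hd
  have hBp : 0 < B ^ (d - 1) := pow_pos (by linarith) _
  have e : B ^ d = B * B ^ (d - 1) := by
    obtain ⟨e, rfl⟩ : ∃ e, d = e + 1 := ⟨d - 1, by omega⟩
    rw [Nat.add_sub_cancel, pow_succ]; ring
  calc A * Real.sqrt (d : ℝ) ≤ A * B ^ (d - 1) := mul_le_mul_of_nonneg_left hs hA
    _ < (c * B) * B ^ (d - 1) := mul_lt_mul_of_pos_right hAc hBp
    _ = c * B ^ d := by rw [e]; ring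

/-! ## Part C. The three cross-scale side conditions of the tree, along the flow -/

section SideConditions
variable (F : Flow) (K : ℕ) {γ β' β₀ : ℝ} {L q₀ : ℕ}

/-- **(a) The side condition `hdom` of `Membership195.rowRung_of_top`** along the flow: for all `m < k ≤ K`,
`3·α_{0,k} ≤ (1 − 2β)·α_{0,m}·L^{2(k−m)}` from the single clause `3(1+β₀) ≤ (1−2β)L²` (no smallness of the
coupling, no `M`). [folklore] -/
theorem hdom_of_flow (S : SmallnessFor γ β' β₀ L q₀) {C₀ β : ℝ} (hC₀ : 0 ≤ C₀)
    (hrg : F.SatisfiesRG K) (hI : F.InInterval γ K) (hub : ∀ j, j < K → F.β (j + 1) (F.g j) ≤ β')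
    (hL : 3 * (1 + β₀) ≤ (1 - 2 * β) * (L : ℝ) ^ 2) {m k : ℕ} (hmk : m < k) (hkK : k ≤ K) :
    3 * alphaK C₀ q₀ F k ≤ (1 - 2 * β) * (alphaK C₀ q₀ F m * (L : ℝ) ^ (2 * (k - m))) := by
  have hch := alphaK_flow_signfree F K S hC₀ hrg hI hub hmk hkK
  have hm := hI m (le_trans hmk.le hkK)
  have hαm : 0 ≤ alphaK C₀ q₀ F m := alphaK_nonneg F hC₀ hm.1 (le_trans hm.2 S.γ_lt_one.le)
  have h2L : (2 : ℝ) ≤ (L : ℝ) := by exact_mod_cast S.hL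
  have hL2 : (2 : ℝ) ≤ (L : ℝ) ^ 2 := by nlinarith
  have hA : (0 : ℝ) ≤ 3 * (1 + β₀) := by linarith [S.β₀_pos]
  have key := poly_le_geom hA hL2 hL (d := k - m) (by omega)
  have ecast : ((k - m : ℕ) : ℝ) = (k : ℝ) - m := Nat.cast_sub hmk.le
  have epow : ((L : ℝ) ^ 2) ^ (k - m) = (L : ℝ) ^ (2 * (k - m)) := by rw [← pow_mul]
  rw [ecast, epow] at key
  calc 3 * alphaK C₀ q₀ F k ≤ 3 * ((1 + β₀) * Real.sqrt ((k : ℝ) - m) * alphaK C₀ q₀ F m) := by linarith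
    _ = (3 * (1 + β₀) * Real.sqrt ((k : ℝ) - m)) * alphaK C₀ q₀ F m := by ring
    _ ≤ ((1 - 2 * β) * (L : ℝ) ^ (2 * (k - m))) * alphaK C₀ q₀ F m := mul_le_mul_of_nonneg_right key hαm
    _ = (1 - 2 * β) * (alphaK C₀ q₀ F m * (L : ℝ) ^ (2 * (k - m))) := by ring

/-- The clause of (a) holds for every block size `L ≥ 3` when `β ≤ 1/4` ([Balaban1989LargeFieldI] p. 190: β a small
positive constant; `Membership195.bare_two_fits_rung` uses `β ≤ 1/4`), because `SmallnessFor` carries `Lβ₀ ≤ 1`: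
`3(1+β₀) ≤ 3(1 + 1/3) = 4 ≤ 9/2 ≤ (1−2β)L²`. [folklore] -/
theorem hdom_clause_of_three_le (S : SmallnessFor γ β' β₀ L q₀) {β : ℝ} (hβ : β ≤ 1 / 4) (hL3 : 3 ≤ L) :
    3 * (1 + β₀) ≤ (1 - 2 * β) * (L : ℝ) ^ 2 := by
  have hL : (3 : ℝ) ≤ (L : ℝ) := by exact_mod_cast hL3
  have h29 := S.h29c
  have hβ₀ := S.β₀_pos
  have h1 : 3 * β₀ ≤ 1 := by nlinarith
  have h2 : (1 : ℝ) / 2 ≤ 1 - 2 * β := by linarith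
  have h3 : (9 : ℝ) ≤ (L : ℝ) ^ 2 := by nlinarith
  have h4 : (1 : ℝ) / 2 * 9 ≤ (1 - 2 * β) * (L : ℝ) ^ 2 := mul_le_mul h2 h3 (by norm_num) (by linarith)
  linarith

/-- **THE TOP RUNG BINDS, along the flow**: `Membership195.rungRows_of_top` with its side conditions `hαm`, `hdom`
discharged — from the top-rung row `X·ε_k ≤ 3·lfFactor β h j k k·α_{0,k}`, the flow hypotheses and
`3(1+β₀) ≤ (1−2β)L²`, every rung `j+1 ≤ m < k` has `X·ε_k ≤ lfFactor β h j m k·(α_{0,m}L^{2(k−m)})`. [folklore] -/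
theorem rungRows_of_top_flow (S : SmallnessFor γ β' β₀ L q₀) {C₀ β X εk : ℝ} {h j k : ℕ} (hC₀ : 0 ≤ C₀)
    (hrg : F.SatisfiesRG K) (hI : F.InInterval γ K) (hub : ∀ j, j < K → F.β (j + 1) (F.g j) ≤ β')
    (hkK : k ≤ K) (hβ0 : 0 ≤ β) (hL : 3 * (1 + β₀) ≤ (1 - 2 * β) * (L : ℝ) ^ 2) (hhj : h ≤ j)
    (hR : X * εk ≤ 3 * lfFactor β h j k k * alphaK C₀ q₀ F k) :
    ∀ m, j + 1 ≤ m → m < k →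
      X * εk ≤ lfFactor β h j m k * (alphaK C₀ q₀ F m * (L : ℝ) ^ (2 * (k - m))) := by
  have hk := hI k hkK
  refine Membership195.rungRows_of_top (α := fun m => alphaK C₀ q₀ F m)
    (G := fun m => (L : ℝ) ^ (2 * (k - m))) hβ0 hhj
    (alphaK_nonneg F hC₀ hk.1 (le_trans hk.2 S.γ_lt_one.le)) ?_ hR ?_
  · intro m _ hmk
    have hm := hI m (le_trans hmk.le hkK)
    exact mul_nonneg (alphaK_nonneg F hC₀ hm.1 (le_trans hm.2 S.γ_lt_one.le))
      (pow_nonneg (Nat.cast_nonneg L) _)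
  · intro m _ hmk
    exact hdom_of_flow F K S hC₀ hrg hI hub hL hmk hkK

/-- … fed by a plaquette within the shape of (1.80) (`Membership195.clause168_rung_of_180`): the rung-`m` line of
(1.68)(iii), `c = 1`, radius `α_{0,m}L^{2(k−m)}η²`, for every `j+1 ≤ m < k`, from the TOP-RUNG row
`(2 + C·B₃B₅M⁵)ε_k ≤ 3·lfFactor β h j k k·α_{0,k}` alone. [folklore] -/
theorem clause168_rungs_of_top_flow (S : SmallnessFor γ β' β₀ L q₀)
    {C₀ β d εk η B₃ B₅ M δ dist C : ℝ} {h j k : ℕ} (hC₀ : 0 ≤ C₀)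
    (hrg : F.SatisfiesRG K) (hI : F.InInterval γ K) (hub : ∀ j, j < K → F.β (j + 1) (F.g j) ≤ β')
    (hkK : k ≤ K) (hβ0 : 0 ≤ β) (hL : 3 * (1 + β₀) ≤ (1 - 2 * β) * (L : ℝ) ^ 2) (hhj : h ≤ j)
    (h180 : Ineq180 d εk η B₃ B₅ M δ dist C) (hX : 0 ≤ C * B₃ * B₅ * M ^ 5) (hε : 0 ≤ εk) (hδ : 0 ≤ δ * dist)
    (hR : (2 + C * B₃ * B₅ * M ^ 5) * εk ≤ 3 * lfFactor β h j k k * alphaK C₀ q₀ F k) :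
    ∀ m, j + 1 ≤ m → m < k →
      Clause168 d β h j m k (cConst m k) (alphaK C₀ q₀ F m * (L : ℝ) ^ (2 * (k - m)) * η ^ 2) :=
  fun m hjm hmk => Membership195.clause168_rung_of_180 hmk h180 hX hε hδ
    (rungRows_of_top_flow F K S hC₀ hrg hI hub hkK hβ0 hL hhj hR m hjm hmk)

/-- **(b) The comparability `hα` of `B14Radii.room_mono_layer`** along the flow, with NO extra clause: for all
`n ≤ k ≤ K`, `α_{0,k} ≤ (L²/2)^{k−n}·α_{0,n}` (`SmallnessFor` carries `L ≥ 2` and `β₀ ≤ 1`, so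
`(1+β₀)√d ≤ 2·2^{d−1} ≤ (L²/2)^d`). [folklore] -/
theorem alphaK_le_halfpow (S : SmallnessFor γ β' β₀ L q₀) {C₀ : ℝ} (hC₀ : 0 ≤ C₀)
    (hrg : F.SatisfiesRG K) (hI : F.InInterval γ K) (hub : ∀ j, j < K → F.β (j + 1) (F.g j) ≤ β')
    {n k : ℕ} (hnk : n ≤ k) (hkK : k ≤ K) :
    alphaK C₀ q₀ F k ≤ ((L : ℝ) ^ 2 / 2) ^ (k - n) * alphaK C₀ q₀ F n := by
  rcases eq_or_lt_of_le hnk with rfl | hlt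
  · simp
  · have hch := alphaK_flow_signfree F K S hC₀ hrg hI hub hlt hkK
    have hn := hI n (le_trans hnk hkK)
    have hαn : 0 ≤ alphaK C₀ q₀ F n := alphaK_nonneg F hC₀ hn.1 (le_trans hn.2 S.γ_lt_one.le)
    have h2L : (2 : ℝ) ≤ (L : ℝ) := by exact_mod_cast S.hL
    have hB : (2 : ℝ) ≤ (L : ℝ) ^ 2 / 2 := by nlinarith
    have hAc : 1 + β₀ ≤ 1 * ((L : ℝ) ^ 2 / 2) := by have := S.β₀_le_one; nlinarith
    have hA : (0 : ℝ) ≤ 1 + β₀ := by linarith [S.β₀_pos]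
    have key := poly_le_geom hA hB hAc (d := k - n) (by omega)
    have ecast : ((k - n : ℕ) : ℝ) = (k : ℝ) - n := Nat.cast_sub hnk
    rw [ecast, one_mul] at key
    calc alphaK C₀ q₀ F k ≤ (1 + β₀) * Real.sqrt ((k : ℝ) - n) * alphaK C₀ q₀ F n := hch
      _ ≤ ((L : ℝ) ^ 2 / 2) ^ (k - n) * alphaK C₀ q₀ F n := mul_le_mul_of_nonneg_right key hαn

/-- Hence `B14Radii.room_mono_layer` with `hα` discharged: along the flow the innermost room (layer `n = k`) is the
smallest, `room A β α_{0,k} L k k ≤ room A β α_{0,n} L k n` for all `n ≤ k ≤ K` (`A, β ≥ 0`; here `β` is the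
contraction constant of [Balaban1988Convergent] (2.34), `L` the block size of `SmallnessFor`). [cite: Balaban1988Convergent, p.277] -/
theorem room_mono_layer_flow (S : SmallnessFor γ β' β₀ L q₀) {C₀ A β : ℝ} (hC₀ : 0 ≤ C₀) (hA : 0 ≤ A)
    (hβ : 0 ≤ β) (hrg : F.SatisfiesRG K) (hI : F.InInterval γ K)
    (hub : ∀ j, j < K → F.β (j + 1) (F.g j) ≤ β') {n k : ℕ} (hnk : n ≤ k) (hkK : k ≤ K) :
    B14Radii.room A β (alphaK C₀ q₀ F k) (L : ℝ) k k ≤ B14Radii.room A β (alphaK C₀ q₀ F n) (L : ℝ) k n := by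
  have h2L : (2 : ℝ) ≤ (L : ℝ) := by exact_mod_cast S.hL
  exact B14Radii.room_mono_layer hA hβ (by linarith) hnk (alphaK_le_halfpow F K S hC₀ hrg hI hub hnk hkK)

/-- `ε_j ≤ (A₀/C₀)·α_{0,j}` at the SAME scale under the reconstructed (X12) `p₀ ≤ q₀` and `log g_j⁻² ≥ 1` — BY NAME
from `B14Radii.fits_of_exponents` (`c = 1`, `κ = A₀/C₀`). [cite: Balaban1988Convergent, (2.28) p.259] -/
theorem epsK_le_ratio_alphaK {A₀ C₀ : ℝ} {p₀ : ℕ} (hA₀ : 0 ≤ A₀) (hC₀ : 0 < C₀) (hpq : p₀ ≤ q₀) {j : ℕ}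
    (hg : 0 < F.g j) (hx : 1 ≤ logInvSq (F.g j)) :
    epsK A₀ p₀ F j ≤ (A₀ / C₀) * alphaK C₀ q₀ F j := by
  have h := B14Radii.fits_of_exponents (c := 1) (κ := A₀ / C₀) (g := F.g j) (x := logInvSq (F.g j))
    zero_le_one hA₀ hg.le hx hpq (by rw [one_mul, div_mul_cancel₀ A₀ hC₀.ne'])
  have e1 : epsK A₀ p₀ F j = 1 * (F.g j * A₀ * (logInvSq (F.g j)) ^ p₀) := by
    unfold epsK p0Profile logInvSq; ring
  have e2 : (A₀ / C₀) * alphaK C₀ q₀ F j = (A₀ / C₀) * (F.g j * C₀ * (logInvSq (F.g j)) ^ q₀) := by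
    unfold alphaK alphaB14; ring
  rw [e1, e2]; exact h

/-- **(c) `Membership195.bare_two_fits_rung` along the flow**: its pair of hypotheses `ε_k < α_{0,m}`, `4 ≤ G` is
replaced by the flow, the reconstructed (X12) `p₀ ≤ q₀` and the single clause `2(A₀/C₀)(1+β₀) < (1−2β)L²`; the
conclusion is the same rung-`m` line (`c = 1`, radius `α_{0,m}L^{2(k−m)}η²`) for the BARE first term `2ε_kη²` of
(1.80), now for EVERY lag `k − m ≥ 1`. [folklore] -/
theorem bare_two_fits_rung_flow (S : SmallnessFor γ β' β₀ L q₀) {A₀ C₀ β η : ℝ} {p₀ h j m k : ℕ}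
    (hA₀ : 0 ≤ A₀) (hC₀ : 0 < C₀) (hpq : p₀ ≤ q₀)
    (hrg : F.SatisfiesRG K) (hI : F.InInterval γ K) (hub : ∀ j, j < K → F.β (j + 1) (F.g j) ≤ β')
    (hβ0 : 0 ≤ β) (hhj : h ≤ j) (hjm : j + 1 ≤ m) (hmk : m < k) (hkK : k ≤ K) (hη : η ≠ 0)
    (hL : 2 * (A₀ / C₀) * (1 + β₀) < (1 - 2 * β) * (L : ℝ) ^ 2) :
    Clause168 (2 * epsK A₀ p₀ F k * η ^ 2) β h j m k (cConst m k)
      (alphaK C₀ q₀ F m * (L : ℝ) ^ (2 * (k - m)) * η ^ 2) := by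
  have hk := hI k hkK
  have hm := hI m (le_trans hmk.le hkK)
  have hx : 1 ≤ logInvSq (F.g k) := one_le_logInvSq S hk.1 hk.2
  have hε := epsK_le_ratio_alphaK F hA₀ hC₀ hpq hk.1 hx
  have hch := alphaK_flow_signfree F K S hC₀.le hrg hI hub hmk hkK
  have hαm : 0 < alphaK C₀ q₀ F m := alphaK_pos F hC₀ hm.1 (lt_of_le_of_lt hm.2 S.γ_lt_one)
  have hAC : 0 ≤ A₀ / C₀ := div_nonneg hA₀ hC₀.le
  have h2L : (2 : ℝ) ≤ (L : ℝ) := by exact_mod_cast S.hL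
  have hL2 : (2 : ℝ) ≤ (L : ℝ) ^ 2 := by nlinarith
  have hA : (0 : ℝ) ≤ 2 * (A₀ / C₀) * (1 + β₀) := by
    have := S.β₀_pos
    have : (0 : ℝ) ≤ 1 + β₀ := by linarith
    positivity
  have key := poly_lt_geom hA hL2 hL (d := k - m) (by omega)
  have ecast : ((k - m : ℕ) : ℝ) = (k : ℝ) - m := Nat.cast_sub hmk.le
  have epow : ((L : ℝ) ^ 2) ^ (k - m) = (L : ℝ) ^ (2 * (k - m)) := by rw [← pow_mul]
  rw [ecast, epow] at key
  have h0 := mul_le_mul_of_nonneg_left hch hAC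
  have h1 : 2 * epsK A₀ p₀ F k ≤
      (2 * (A₀ / C₀) * (1 + β₀) * Real.sqrt ((k : ℝ) - m)) * alphaK C₀ q₀ F m := by
    have e : (2 * (A₀ / C₀) * (1 + β₀) * Real.sqrt ((k : ℝ) - m)) * alphaK C₀ q₀ F m =
        2 * ((A₀ / C₀) * ((1 + β₀) * Real.sqrt ((k : ℝ) - m) * alphaK C₀ q₀ F m)) := by ring
    rw [e]; linarith
  have h2 : (2 * (A₀ / C₀) * (1 + β₀) * Real.sqrt ((k : ℝ) - m)) * alphaK C₀ q₀ F m <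
      ((1 - 2 * β) * (L : ℝ) ^ (2 * (k - m))) * alphaK C₀ q₀ F m := mul_lt_mul_of_pos_right key hαm
  have hFm : 1 - 2 * β ≤ lfFactor β h j m k := Membership195.lfFactor_rung_ge hβ0 hhj hjm k
  have hαG : 0 ≤ alphaK C₀ q₀ F m * (L : ℝ) ^ (2 * (k - m)) :=
    mul_nonneg hαm.le (pow_nonneg (Nat.cast_nonneg L) _)
  have h3 : (1 - 2 * β) * (alphaK C₀ q₀ F m * (L : ℝ) ^ (2 * (k - m))) ≤
      lfFactor β h j m k * (alphaK C₀ q₀ F m * (L : ℝ) ^ (2 * (k - m))) := mul_le_mul_of_nonneg_right hFm hαG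
  have h4 : 2 * epsK A₀ p₀ F k < lfFactor β h j m k * (alphaK C₀ q₀ F m * (L : ℝ) ^ (2 * (k - m))) := by
    have e : ((1 - 2 * β) * (L : ℝ) ^ (2 * (k - m))) * alphaK C₀ q₀ F m =
        (1 - 2 * β) * (alphaK C₀ q₀ F m * (L : ℝ) ^ (2 * (k - m))) := by ring
    linarith
  have hη2 : 0 < η ^ 2 := by positivity
  unfold Clause168 Clause164
  rw [Membership195.cConst_below hmk]
  calc 2 * epsK A₀ p₀ F k * η ^ 2
      < lfFactor β h j m k * (alphaK C₀ q₀ F m * (L : ℝ) ^ (2 * (k - m))) * η ^ 2 :=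
        mul_lt_mul_of_pos_right h4 hη2
    _ = lfFactor β h j m k * 1 * (alphaK C₀ q₀ F m * (L : ℝ) ^ (2 * (k - m)) * η ^ 2) := by ring

/-- The clause of (c) holds for `A₀ ≤ C₀` ((2.28): *"C₀ … sufficiently large"*), `β ≤ 1/4` and every `L ≥ 3`
(`SmallnessFor`: `Lβ₀ ≤ 1`): `2(A₀/C₀)(1+β₀) ≤ 2(1 + 1/3) < 9/2 ≤ (1−2β)L²`. [folklore] -/
theorem bare_clause_of_three_le (S : SmallnessFor γ β' β₀ L q₀) {A₀ C₀ β : ℝ} (hA₀ : 0 ≤ A₀) (hC₀ : 0 < C₀)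
    (hAC : A₀ ≤ C₀) (hβ : β ≤ 1 / 4) (hL3 : 3 ≤ L) :
    2 * (A₀ / C₀) * (1 + β₀) < (1 - 2 * β) * (L : ℝ) ^ 2 := by
  have hr : A₀ / C₀ ≤ 1 := by rw [div_le_one hC₀]; exact hAC
  have hr0 : 0 ≤ A₀ / C₀ := div_nonneg hA₀ hC₀.le
  have hL : (3 : ℝ) ≤ (L : ℝ) := by exact_mod_cast hL3
  have h29 := S.h29c
  have hβ₀ := S.β₀_pos
  have h1 : 3 * β₀ ≤ 1 := by nlinarith
  have h2 : 2 * (A₀ / C₀) * (1 + β₀) ≤ 2 * (1 + β₀) := by nlinarith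
  have h3 : (9 : ℝ) ≤ (L : ℝ) ^ 2 := by nlinarith
  have h4 : (1 : ℝ) / 2 * 9 ≤ (1 - 2 * β) * (L : ℝ) ^ 2 := mul_le_mul (by linarith) h3 (by norm_num) (by linarith)
  linarith

end SideConditions

/-! ## Part D. Non-vacuity of the hypotheses -/

/-- An instance of the smallness structure with block size `L = 4`: `γ = e^{−10}`, `β′ = 1`, `β₀ = 1/4`, `q₀ = 2`.
[folklore] -/
theorem smallnessFor_L4 : SmallnessFor (Real.exp (-10)) 1 (1 / 4) 4 2 := by
  have hγ : Real.exp (-10) < 1 := Real.exp_lt_one_iff.mpr (by norm_num)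
  have hγ2 : Real.exp (-10) ^ 2 ≤ 1 := by
    have := Real.exp_pos (-10)
    nlinarith
  have hsmall : Real.exp (-10) ^ 2 ≤ 1 / 4 := by
    have h1 : Real.exp (-10) * Real.exp 10 = 1 := by rw [← Real.exp_add]; norm_num
    have h11 : (11 : ℝ) ≤ Real.exp 10 := by linarith [Real.add_one_le_exp (10 : ℝ)]
    have hpos := Real.exp_pos (-10)
    have he : Real.exp (-10) ≤ 1 / 11 := by nlinarith
    nlinarith
  have hlog : Real.log (Real.exp (-10) ^ 2)⁻¹ = 20 := by
    rw [Real.log_inv, Real.log_pow, Real.log_exp]; norm_num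
  refine ⟨Real.exp_pos _, hγ, by norm_num, by norm_num, by norm_num, ?_, ?_, ?_, ?_, by norm_num, by norm_num⟩
  · linarith
  · linarith
  · rw [hlog]; norm_num
  · rw [hlog]; norm_num

/-- NON-VACUITY of Parts A–C: the flat flow of `…B15Ineq194Flow` (`g ≡ e^{−10}`, `β ≡ 0 ≤ β′ = 1`) with
`γ = e^{−10}`, `β₀ = 1/4`, `L = 4`, `q₀ = 2`, line constant `β = 1/4` and `A₀ = C₀ = 1` satisfies every hypothesis
of `hdom_of_flow`, `alphaK_le_halfpow` and `bare_two_fits_rung_flow` simultaneously (any `K`). [folklore] -/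
theorem hypotheses_inhabited (K : ℕ) :
    ∃ (F : Flow) (γ β' β₀ β A₀ C₀ : ℝ) (L q₀ : ℕ),
      SmallnessFor γ β' β₀ L q₀ ∧ F.SatisfiesRG K ∧ F.InInterval γ K ∧
      (∀ j, j < K → F.β (j + 1) (F.g j) ≤ β') ∧ 0 ≤ β ∧ β ≤ 1 / 4 ∧ 0 ≤ A₀ ∧ 0 < C₀ ∧
      3 * (1 + β₀) ≤ (1 - 2 * β) * (L : ℝ) ^ 2 ∧ 2 * (A₀ / C₀) * (1 + β₀) < (1 - 2 * β) * (L : ℝ) ^ 2 := by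
  refine ⟨Ineq194Flow.flatFlow, Real.exp (-10), 1, 1 / 4, 1 / 4, 1, 1, 4, 2, smallnessFor_L4,
    Ineq194Flow.flatFlow_satisfiesRG K, Ineq194Flow.flatFlow_inInterval K,
    Ineq194Flow.flatFlow_beta_le K, by norm_num, by norm_num, by norm_num, by norm_num, ?_, ?_⟩
  · norm_num
  · norm_num

end Literature.MathematicalPhysics.QuantumFieldTheory.Balaban1983to89.B15.RadiiAlongFlow
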